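import Summits.ABC.IUTFork.Cor312LicenceRealSharpMovers
import Summits.ABC.IUTFork.Cor312PilotKummerCompat
import Summits.ABC.IUTFork.Cor312ProvKIdeles
import HarnessLib

/-!
# [IUTchIII] Cor. 3.12 — branch C's hull-level S_H at the PINNED q-reading IS the (xi-f) licence: the label-`0` cell is free
# (any sharp assembled real setting with `‖t_q‖ ≤ 1`; every REALISING q-idele; the K record line's chosen ideles)

PROOF-ONLY file (D-0012; 0 definitions, 0 `Prop` facts, no instance, no notation) of the abc-iut cell (branch C certificate seat
abc-iut-C-cert-2, gen 5; successor item (3) of gen 4's HANDOFF «converse ordering γ-K ⟹ (U)-K at d = 1 needs S_H ⟸ Licence (label-0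
packet analysis)»). TAKES NO SIDE on [IUTchIII] Cor. 3.12 (kurims manuscript p. 173–174; Step (xi-f) p. 184 l. 26–29) or on the
reading (U)/(P): every statement is about OUR typed objects; «iff by theorem», nothing about `ABC`.

The (U) books of branch C (`Conditional.abc_of_SH_orNum_K_szpiroBad` and its companions) carry the antecedent
`S_H := Cor312Vol.PilotKummerCompatHull S P (fun _ => P.qRegion) qK` — abc-iut-w5-d068's HULL-LEVEL clause READ AT THE PINNED REGION
OPERATOR `ρ := fun _ => P.qRegion` (so abc-iut-w5-d230's q-pin `QPinned` holds by `rfl`): «at EVERY label `j ∈ {0, …, l⋇}` and every `v_ℚ`,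
the q-pilot region lies in the holomorphic hull `ⁿ˒°𝒰_{j,v_ℚ}` of the union of the possible images of the Θ-pilot». abc-iut-c312-1's (xi-f)
`Thm311ToCor312.Licence P` is the SAME inclusion at the labels of `𝔽_l^⋇` only (`j = i+1`; w5-d068 `licence_of_pilotKummerCompatHull`,
`pilotKummerCompatHull_labelSucc_iff_licence`). The difference is the ONE label `0`, where — at abc-iut-c312-7's sharp assembled real
setting `Real.settingPrVolSharp` — the Θ-box is the UNIT box (`labelIdele … 0 = 1`, Dupuy–Hilado §3.9 «`𝒪_{v⃗}` in the other degrees»)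
and the q-box is `ι(t_q)·(R_I)^∼`; so the label-`0` cell holds as soon as `‖t_{q,x}‖ ≤ 1` at every place (abc-iut-rp-d1 lineage's
`qRegion_subset_thetaRegion_settingPrVolSharp_inr/_inl` + `thetaRegion_subset_thetaHull_settingPrVolSharp`, exactly the two lines of
abc-iut-w5-d217's `exists_qPinned_and_pilotKummerCompatHull_settingPrVolSharp_of_tame`), which EVERY realising q-idele satisfies
(`log ‖t_{q,x}‖ = −P_q(x)·log N(x)/[K_x:ℚ_p] ≤ 0` since `P_q ≥ 0`, [IUTchI] Def. 3.1 (b)(c) / Dupuy–Hilado (3.3)).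

* §1 `Cor312Vol.pilotKummerCompatHull_qRegion_iff_licence_of_label_zero` (any setting whose label-`0` cells hold; the bare unfolding is
  the R-H lane's `Repair.CandInternal11GapLabelCut.pilotKummerCompatHull_const_iff`, not restated) · `…_of_licence_of_label_zero`.
* §2 `Thm311.Real.norm_le_one_of_realises` (realising q-ideles have norm `≤ 1`) · `qRegion_subset_thetaHull_settingPrVolSharp_zero`
  (the label-`0` cell at `settingPrVolSharp` from `‖t_q‖ ≤ 1`) · **`pilotKummerCompatHull_settingPrVolSharp_iff_licence`** (S_H at the pinned
  reading ⟺ the (xi-f) licence, ANY pilot datum `X`, ANY context/column binders, ANY `qK`, Θ-ideles `t ≠ 0`, q-ideles with `‖t_q‖ ≤ 1`) ·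
  `…_iff_licence_of_realises`.
* §3 **`Cor312Prov.pilotKummerCompatHull_iff_licence_settingPrVolSharp_pilotDataOfK`** — the K record line: at abc-iut-C-cert-3's `K`-level
  pilot datum `pilotDataOfK D K` with the CHOSEN realising q-ideles `(exists_realising_qIdeles_pilotDataOfK D).choose` (the very term of the
  K books) and ANY Θ-ideles `t ≠ 0`: `S_H ⟺ Licence`, at every degree `d_mod`. Consequence (next file, VERBATIM binder texts): with this
  seat's `slotLicence_iff_licence_settingPrVolSharp_pilotDataOfK_of_finrank_eq_one` (p479179) and abc-iut-c312-d1's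
  `cor312Of_iff_perImage_of_finrank_eq_one`, at `d_mod = 1` the (U)-K binder instance and the γ-K binder instance are EQUIVALENT.

HONEST SCOPE: identities between OUR typed predicates; no binder of any certificate is discharged; the per-label sharp licence is a
STRONGER-THAN-PRINT reading (ADJUDICATION-SPEC §2 (G1′)); decided-as-typed ≠ in print; typed ≠ proved (this: proved).
[cite: Mochizuki2012, IUTchIII Cor. 3.12 p. 173–174, Step (xi-d) p. 183, Step (xi-f) p. 184; IUTchI Def. 3.1 (b)(c) p. 61–62]
[cite: DupuyHilado2025, §3.3 (3.3), §3.7, §3.9] [claim: Mochizuki2012, status: disputed] for every IUT sentence quoted.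
-/

noncomputable section

open Set Function NumberField IsDedekindDomain

namespace Summit.ABC.IUTFork

/-! ## §1. Any situation: S_H at the pinned reading vs the (xi-f) licence — the label `0` is the only difference -/

namespace Cor312Vol

open Thm311 Cor312 Literature.IUT.LogThetaLattice

variable {T : ThetaIndex} (S : LatticeSituation T) (P : Cor312.Setting S.toSituation)
  (qK : ∀ v : T.V, v ∈ T.Vbad → Set (S.L.StarPacket v))

/- NOTE: the unfolding `PilotKummerCompatHull S P (fun _ => P.qRegion) qK ↔ ∀ j vQ, qRegion ⊆ thetaHull` is already landed as
`Summit.ABC.IUTFork.Repair.CandInternal11GapLabelCut.pilotKummerCompatHull_const_iff` (R-H lane); not restated here (gate dedup). -/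

/-- **S_H (pinned reading) ⟺ the (xi-f) licence, for a setting whose label-`0` cells hold.** [cite: Mochizuki2012, IUTchIII
Cor. 3.12 Step (xi-f) p. 184] [claim: Mochizuki2012, status: disputed] -/
theorem pilotKummerCompatHull_qRegion_iff_licence_of_label_zero
    (h0 : ∀ vQ : T.VQ, P.qRegion 0 vQ ⊆ P.thetaHull 0 vQ) :
    PilotKummerCompatHull S P (fun _ => P.qRegion) qK ↔ Thm311ToCor312.Licence P := by
  refine ⟨fun h => licence_of_pilotKummerCompatHull S P (fun _ => P.qRegion) qK (fun _ _ => rfl) h, fun h j vQ => ?_⟩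
  rcases Fin.eq_zero_or_eq_succ j with rfl | ⟨i, rfl⟩
  · exact h0 vQ
  · exact h i vQ

/-- The converse direction alone: the licence plus the label-`0` cells give S_H at the pinned reading (for ANY `qK`).
[cite: Mochizuki2012, IUTchIII Cor. 3.12 Step (xi-f) p. 184] [claim: Mochizuki2012, status: disputed] -/
theorem pilotKummerCompatHull_qRegion_of_licence_of_label_zero
    (h0 : ∀ vQ : T.VQ, P.qRegion 0 vQ ⊆ P.thetaHull 0 vQ) (h : Thm311ToCor312.Licence P) :
    PilotKummerCompatHull S P (fun _ => P.qRegion) qK :=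
  (pilotKummerCompatHull_qRegion_iff_licence_of_label_zero S P qK h0).2 h

end Cor312Vol

/-! ## §2. The sharp assembled real setting: the label-`0` cell from `‖t_q‖ ≤ 1`; realising q-ideles -/

namespace Thm311.Real

open Cor312 Cor312Vol Literature.IUT.LogThetaLattice Literature.IUT.LogVolume
  Literature.NumberTheory.NumberFields Literature.NumberTheory.GaloisRepresentations.Ultrametric

section Assembled

variable {F : Type} [Field F] [NumberField F] (X : PilotData F) {logv : PadicLogs F} (hlog : LogvAnalytic logv)
  (M : Type) [Field M] [NumberField M]
  (archPk : ∀ (j : (thetaIndex X).Label) (vQ : (thetaIndex X).VQ), Set ((logShellsDH X logv).Packet j vQ))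
  (archSub : ∀ (j : (thetaIndex X).Label) (v : (thetaIndex X).V),
    Set ((logShellsDH X logv).Packet j ((thetaIndex X).over v)))
  (Ψ : ℤ → ∀ v : (thetaIndex X).V, v ∈ (thetaIndex X).Vbad → Set ((logShellsDH X logv).StarPacket v))
  (act : ℤ → ∀ v : (thetaIndex X).V, v ∈ (thetaIndex X).Vbad →
    (logShellsDH X logv).StarPacket v → Module.End ℚ ((logShellsDH X logv).StarPacket v))
  (Mmod : ℤ → ∀ j : (thetaIndex X).LabelStar, Set ((logShellsDH X logv).GlobalPacket j.1))
  (region : ℤ → ∀ j : (thetaIndex X).LabelStar, FinDivisor M → ∀ vQ : (thetaIndex X).VQ,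
    Set ((logShellsDH X logv).Packet j.1 vQ))
  (n : ℤ) {HT : Type} {LogLink : HT → HT → Type} {IsFull : ∀ {s t : HT}, LogLink s t → Prop}
  (lat : LGPGaussianLogThetaLattice LogLink IsFull)
  {Frd : Type} {IsoF : Frd → Frd → Type} {Ob : Frd → Type} {realify : Frd → Frd} {Strip : Type}
  {IsoS : Strip → Strip → Type} {Mv : ∀ v : (thetaIndex X).V, v ∈ (thetaIndex X).Vbad → Type}
  [∀ v h, Monoid (Mv v h)]
  (sig : GlobalLGPFrobenioidSignature (thetaIndex X).lstar (thetaIndex X).V (· ∈ (thetaIndex X).Vbad)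
    Frd IsoF Ob realify Strip IsoS Mv)
  (split : SplittingMonoids Mv) {ObΔ : Type} {N : ∀ v : (thetaIndex X).V, v ∈ (thetaIndex X).Vbad → Type}
  [∀ v h, Monoid (N v h)] (qData : QPilotData ObΔ N)
  (tq : ∀ (pp : Nat.Primes) (x : (thetaIndex X).Fibre (.inr pp)),
    haveI : Fact (pp : ℕ).Prime := ⟨pp.2⟩; kOf X pp.1 x)
  (t : ∀ (pp : Nat.Primes) (_ : Fin X.lstar) (x : (thetaIndex X).Fibre (.inr pp)),
    haveI : Fact (pp : ℕ).Prime := ⟨pp.2⟩; kOf X pp.1 x)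
  (htq0 : ∀ pp x, tq pp x ≠ 0)
  (htq1 : ∀ (pp : Nat.Primes) (x : (thetaIndex X).Fibre (.inr pp)),
    haveI : Fact (pp : ℕ).Prime := ⟨pp.2⟩; placeOf X pp.1 x ∉ X.S → ‖tq pp x‖ = 1)

include htq0 in
/-- **Realising q-ideles have norm `≤ 1`**: if `log ‖t_{q,x}‖ = −P_q(x)·log N(x)/[K_x : ℚ_p]` (abc-iut-c312-3's REALISING
reading of the q-pilot divisor, Dupuy–Hilado (3.3)) then `‖t_{q,x}‖ ≤ 1`, because `P_q(x) = ord_x(q)/2l ≥ 0` on `S` and `0` off `S`.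
[cite: Mochizuki2012, IUTchI Def. 3.1 (b)(c) p. 61–62] [cite: DupuyHilado2025, §3.3] -/
theorem norm_le_one_of_realises
    (htq : ∀ (pp : Nat.Primes) (x : (thetaIndex X).Fibre (.inr pp)),
      haveI : Fact (pp : ℕ).Prime := ⟨pp.2⟩
      Real.log ‖tq pp x‖ = -(X.qPilot (placeOf X pp.1 x)) * logNorm F (placeOf X pp.1 x) / localDegree F (placeOf X pp.1 x))
    (pp : Nat.Primes) (x : (thetaIndex X).Fibre (.inr pp)) :
    haveI : Fact (pp : ℕ).Prime := ⟨pp.2⟩; ‖tq pp x‖ ≤ 1 := by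
  haveI : Fact (pp : ℕ).Prime := ⟨pp.2⟩
  have hq0 : 0 < ‖tq pp x‖ := norm_pos_iff.mpr (htq0 pp x)
  rw [← Real.log_nonpos_iff hq0.le, htq pp x]
  have h1 : 0 ≤ X.qPilot (placeOf X pp.1 x) := by
    by_cases hS : placeOf X pp.1 x ∈ X.S
    · rw [X.qPilot_apply_of_mem hS]
      exact div_nonneg (by exact_mod_cast (X.ordq_pos hS).le) X.two_mul_l_pos.le
    · rw [X.qPilot_apply_of_not_mem hS]
  have h2 : 0 < logNorm F (placeOf X pp.1 x) := logNorm_pos F _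
  have h3 : (0 : ℝ) < localDegree F (placeOf X pp.1 x) := by exact_mod_cast localDegree_pos F _
  have : 0 ≤ X.qPilot (placeOf X pp.1 x) * logNorm F (placeOf X pp.1 x) / localDegree F (placeOf X pp.1 x) :=
    div_nonneg (mul_nonneg h1 h2.le) h3.le
  rw [neg_mul, neg_div]
  linarith

/-- **The label-`0` cell at the sharp assembled real setting**: if `‖t_{q,x}‖ ≤ 1` at every place, then at the label `0` (where the
Θ-box is the unit box, `labelIdele … 0 = 1`) the q-pilot region lies in the Θ-region of every Kummer index, hence in the packet hull —
at every `v_ℚ` (the archimedean packets are trivial containers). [cite: DupuyHilado2025, §3.7, §3.9]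
[cite: Mochizuki2012, IUTchIII Cor. 3.12 Step (xi-f) p. 184] [claim: Mochizuki2012, status: disputed] -/
theorem qRegion_subset_thetaHull_settingPrVolSharp_zero (ht0 : ∀ pp i x, t pp i x ≠ 0)
    (htq_le : ∀ pp x, ‖tq pp x‖ ≤ 1) (vQ : (thetaIndex X).VQ) :
    (settingPrVolSharp X hlog M archPk archSub Ψ act Mmod region n lat sig split qData tq t htq0 htq1).qRegion 0 vQ ⊆
      (settingPrVolSharp X hlog M archPk archSub Ψ act Mmod region n lat sig split qData tq t htq0 htq1).thetaHull 0 vQ := by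
  rcases vQ with u | pp
  · exact (qRegion_subset_thetaRegion_settingPrVolSharp_inl X hlog M archPk archSub Ψ act Mmod region n lat sig split
        qData tq t htq0 htq1 0 _ u).trans
      (thetaRegion_subset_thetaHull_settingPrVolSharp X hlog M archPk archSub Ψ act Mmod region n lat sig split qData tq
        t htq0 htq1 0 _ _)
  · haveI : Fact (pp : ℕ).Prime := ⟨pp.2⟩
    refine (qRegion_subset_thetaRegion_settingPrVolSharp_inr X hlog M archPk archSub Ψ act Mmod region n lat sig split
        qData tq t htq0 htq1 ht0 0 _ pp fun x => ?_).trans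
      (thetaRegion_subset_thetaHull_settingPrVolSharp X hlog M archPk archSub Ψ act Mmod region n lat sig split qData tq
        t htq0 htq1 0 _ _)
    have h0 : labelIdele X t pp 0 x = 1 := by
      unfold labelIdele
      rw [dif_neg (by simp)]
    rw [h0, norm_one]
    exact htq_le pp x

variable (frobAdm : ℤ → ℤ → ∀ (j : (thetaIndex X).Label) (vQ : (thetaIndex X).VQ),
    Set ((logShellsDH X logv).Packet j vQ) → Prop)
  (frobLogvol : ℤ → ℤ → ∀ (j : (thetaIndex X).Label) (vQ : (thetaIndex X).VQ),
    Set ((logShellsDH X logv).Packet j vQ) → ℝ)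
  (frobΨ : ℤ → ℤ → ∀ v : (thetaIndex X).V, v ∈ (thetaIndex X).Vbad → Set ((logShellsDH X logv).StarPacket v))
  (frobMmod : ℤ → ℤ → ∀ j : (thetaIndex X).LabelStar, Set ((logShellsDH X logv).GlobalPacket j.1))
  (unitImage : ℤ → ℤ → ℕ → ∀ (j : (thetaIndex X).Label) (vQ : (thetaIndex X).VQ),
    Set ((logShellsDH X logv).Packet j vQ))
  (ballImage : ℤ → ℤ → ∀ (j : (thetaIndex X).Label) (vQ : (thetaIndex X).VQ),
    Set ((logShellsDH X logv).Packet j vQ))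
  (thetaDiv : ℤ → ℤ → LgpDivisor M (thetaIndex X).lstar)
  (qK : ∀ v : (thetaIndex X).V, v ∈ (thetaIndex X).Vbad → Set ((logShellsDH X logv).StarPacket v))

/-- **S_H (pinned reading) ⟺ the (xi-f) LICENCE at the sharp assembled real setting**, for ANY pilot datum `X`, ANY context and
column binders, ANY q-datum `qK`, Θ-ideles `t ≠ 0` and q-ideles with `‖t_q‖ ≤ 1`: the branch-C (U) books' antecedent
`PilotKummerCompatHull (LatticeSituation.ofShells …) (settingPrVolSharp …) (fun _ => qRegion) qK` and abc-iut-c312-1's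
`Thm311ToCor312.Licence (settingPrVolSharp …)` are ONE predicate. [cite: Mochizuki2012, IUTchIII Cor. 3.12 Step (xi-d) p. 183, (xi-f) p. 184]
[cite: DupuyHilado2025, §3.9] [claim: Mochizuki2012, status: disputed] -/
theorem pilotKummerCompatHull_settingPrVolSharp_iff_licence (ht0 : ∀ pp i x, t pp i x ≠ 0)
    (htq_le : ∀ pp x, ‖tq pp x‖ ≤ 1) :
    Cor312Vol.PilotKummerCompatHull
        (LatticeSituation.ofShells (logShellsDH X logv) M archPk archSub (summandPiecesPr X hlog).Adm
          (summandPiecesPr X hlog).logvol Ψ act Mmod region frobAdm frobLogvol frobΨ frobMmod unitImage ballImage thetaDiv)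
        (settingPrVolSharp X hlog M archPk archSub Ψ act Mmod region n lat sig split qData tq t htq0 htq1)
        (fun _ => (settingPrVolSharp X hlog M archPk archSub Ψ act Mmod region n lat sig split qData tq t htq0 htq1).qRegion)
        qK ↔
      Thm311ToCor312.Licence
        (settingPrVolSharp X hlog M archPk archSub Ψ act Mmod region n lat sig split qData tq t htq0 htq1) :=
  Cor312Vol.pilotKummerCompatHull_qRegion_iff_licence_of_label_zero _ _ qK
    (qRegion_subset_thetaHull_settingPrVolSharp_zero X hlog M archPk archSub Ψ act Mmod region n lat sig split qData tq t
      htq0 htq1 ht0 htq_le)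

/-- **The same for REALISING q-ideles** (`log ‖t_{q,x}‖ = −P_q(x)·log N(x)/[K_x : ℚ_p]`; `‖t_q‖ ≤ 1` is then automatic).
[cite: Mochizuki2012, IUTchIII Cor. 3.12 Step (xi-f) p. 184; IUTchI Def. 3.1 (b)(c) p. 61–62] [cite: DupuyHilado2025, §3.3, §3.9]
[claim: Mochizuki2012, status: disputed] -/
theorem pilotKummerCompatHull_settingPrVolSharp_iff_licence_of_realises (ht0 : ∀ pp i x, t pp i x ≠ 0)
    (htq : ∀ (pp : Nat.Primes) (x : (thetaIndex X).Fibre (.inr pp)),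
      haveI : Fact (pp : ℕ).Prime := ⟨pp.2⟩
      Real.log ‖tq pp x‖ = -(X.qPilot (placeOf X pp.1 x)) * logNorm F (placeOf X pp.1 x) / localDegree F (placeOf X pp.1 x)) :
    Cor312Vol.PilotKummerCompatHull
        (LatticeSituation.ofShells (logShellsDH X logv) M archPk archSub (summandPiecesPr X hlog).Adm
          (summandPiecesPr X hlog).logvol Ψ act Mmod region frobAdm frobLogvol frobΨ frobMmod unitImage ballImage thetaDiv)
        (settingPrVolSharp X hlog M archPk archSub Ψ act Mmod region n lat sig split qData tq t htq0 htq1)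
        (fun _ => (settingPrVolSharp X hlog M archPk archSub Ψ act Mmod region n lat sig split qData tq t htq0 htq1).qRegion)
        qK ↔
      Thm311ToCor312.Licence
        (settingPrVolSharp X hlog M archPk archSub Ψ act Mmod region n lat sig split qData tq t htq0 htq1) :=
  pilotKummerCompatHull_settingPrVolSharp_iff_licence X hlog M archPk archSub Ψ act Mmod region n lat sig split qData tq t
    htq0 htq1 frobAdm frobLogvol frobΨ frobMmod unitImage ballImage thetaDiv qK ht0
    (norm_le_one_of_realises X tq htq0 htq)

end Assembled

end Thm311.Real

/-! ## §3. The K record line: the `K`-level pilot datum with the K books' CHOSEN realising q-ideles -/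

namespace Cor312Prov

open Thm311 Thm311.Real Cor312 Cor312Vol Literature.IUT.LogThetaLattice Literature.IUT.LogVolume
  Literature.IUT.HodgeTheaters Literature.NumberTheory.NumberFields

variable {F K Fbar : Type} [Field F] [NumberField F] [Field K] [NumberField K] [Algebra F K] [Field Fbar]
  [Algebra F Fbar] [Algebra K Fbar] {E : WeierstrassCurve F} [E.IsElliptic] {l : ℕ} {Pb : BadPlacePredicates K}
  (D : InitialThetaData F K Fbar E l Pb)
  {logv : PadicLogs K} (hlog : LogvAnalytic logv)
  (M : Type) [Field M] [NumberField M]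
  (archPk : ∀ (j : (thetaIndex (pilotDataOfK D K)).Label) (vQ : (thetaIndex (pilotDataOfK D K)).VQ),
    Set ((logShellsDH (pilotDataOfK D K) logv).Packet j vQ))
  (archSub : ∀ (j : (thetaIndex (pilotDataOfK D K)).Label) (v : (thetaIndex (pilotDataOfK D K)).V),
    Set ((logShellsDH (pilotDataOfK D K) logv).Packet j ((thetaIndex (pilotDataOfK D K)).over v)))
  (Ψ : ℤ → ∀ v : (thetaIndex (pilotDataOfK D K)).V, v ∈ (thetaIndex (pilotDataOfK D K)).Vbad →
    Set ((logShellsDH (pilotDataOfK D K) logv).StarPacket v))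
  (act : ℤ → ∀ v : (thetaIndex (pilotDataOfK D K)).V, v ∈ (thetaIndex (pilotDataOfK D K)).Vbad →
    (logShellsDH (pilotDataOfK D K) logv).StarPacket v → Module.End ℚ ((logShellsDH (pilotDataOfK D K) logv).StarPacket v))
  (Mmod : ℤ → ∀ j : (thetaIndex (pilotDataOfK D K)).LabelStar, Set ((logShellsDH (pilotDataOfK D K) logv).GlobalPacket j.1))
  (region : ℤ → ∀ j : (thetaIndex (pilotDataOfK D K)).LabelStar, FinDivisor M → ∀ vQ : (thetaIndex (pilotDataOfK D K)).VQ,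
    Set ((logShellsDH (pilotDataOfK D K) logv).Packet j.1 vQ))
  (n : ℤ) {HT : Type} {LogLink : HT → HT → Type} {IsFull : ∀ {s t : HT}, LogLink s t → Prop}
  (lat : LGPGaussianLogThetaLattice LogLink IsFull)
  {Frd : Type} {IsoF : Frd → Frd → Type} {Ob : Frd → Type} {realify : Frd → Frd} {Strip : Type}
  {IsoS : Strip → Strip → Type}
  {Mv : ∀ v : (thetaIndex (pilotDataOfK D K)).V, v ∈ (thetaIndex (pilotDataOfK D K)).Vbad → Type} [∀ v h, Monoid (Mv v h)]
  (sig : GlobalLGPFrobenioidSignature (thetaIndex (pilotDataOfK D K)).lstar (thetaIndex (pilotDataOfK D K)).V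
    (· ∈ (thetaIndex (pilotDataOfK D K)).Vbad) Frd IsoF Ob realify Strip IsoS Mv)
  (split : SplittingMonoids Mv) {ObΔ : Type}
  {N : ∀ v : (thetaIndex (pilotDataOfK D K)).V, v ∈ (thetaIndex (pilotDataOfK D K)).Vbad → Type} [∀ v h, Monoid (N v h)]
  (qData : QPilotData ObΔ N)
  (t : ∀ (pp : Nat.Primes) (_ : Fin (pilotDataOfK D K).lstar) (x : (thetaIndex (pilotDataOfK D K)).Fibre (.inr pp)),
    haveI : Fact (pp : ℕ).Prime := ⟨pp.2⟩; kOf (pilotDataOfK D K) pp.1 x)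
  (frobAdm : ℤ → ℤ → ∀ (j : (thetaIndex (pilotDataOfK D K)).Label) (vQ : (thetaIndex (pilotDataOfK D K)).VQ),
    Set ((logShellsDH (pilotDataOfK D K) logv).Packet j vQ) → Prop)
  (frobLogvol : ℤ → ℤ → ∀ (j : (thetaIndex (pilotDataOfK D K)).Label) (vQ : (thetaIndex (pilotDataOfK D K)).VQ),
    Set ((logShellsDH (pilotDataOfK D K) logv).Packet j vQ) → ℝ)
  (frobΨ : ℤ → ℤ → ∀ v : (thetaIndex (pilotDataOfK D K)).V, v ∈ (thetaIndex (pilotDataOfK D K)).Vbad →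
    Set ((logShellsDH (pilotDataOfK D K) logv).StarPacket v))
  (frobMmod : ℤ → ℤ → ∀ j : (thetaIndex (pilotDataOfK D K)).LabelStar, Set ((logShellsDH (pilotDataOfK D K) logv).GlobalPacket j.1))
  (unitImage : ℤ → ℤ → ℕ → ∀ (j : (thetaIndex (pilotDataOfK D K)).Label) (vQ : (thetaIndex (pilotDataOfK D K)).VQ),
    Set ((logShellsDH (pilotDataOfK D K) logv).Packet j vQ))
  (ballImage : ℤ → ℤ → ∀ (j : (thetaIndex (pilotDataOfK D K)).Label) (vQ : (thetaIndex (pilotDataOfK D K)).VQ),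
    Set ((logShellsDH (pilotDataOfK D K) logv).Packet j vQ))
  (thetaDiv : ℤ → ℤ → LgpDivisor M (thetaIndex (pilotDataOfK D K)).lstar)
  (qK : ∀ v : (thetaIndex (pilotDataOfK D K)).V, v ∈ (thetaIndex (pilotDataOfK D K)).Vbad →
    Set ((logShellsDH (pilotDataOfK D K) logv).StarPacket v))

/-- The K books' CHOSEN realising q-ideles `(exists_realising_qIdeles_pilotDataOfK D).choose` have norm `≤ 1` everywhere
(their `choose_spec.2.2` is the realising reading). [cite: Mochizuki2012, IUTchI Def. 3.1 (b)(c) p. 61–62, Ex. 3.2 (iv) p. 71]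
[cite: DupuyHilado2025, §3.3] -/
theorem norm_choose_realising_qIdeles_pilotDataOfK_le_one (pp : Nat.Primes)
    (x : (thetaIndex (pilotDataOfK D K)).Fibre (.inr pp)) :
    haveI : Fact (pp : ℕ).Prime := ⟨pp.2⟩; ‖(exists_realising_qIdeles_pilotDataOfK D).choose pp x‖ ≤ 1 :=
  norm_le_one_of_realises (pilotDataOfK D K) (exists_realising_qIdeles_pilotDataOfK D).choose
    (exists_realising_qIdeles_pilotDataOfK D).choose_spec.1 (exists_realising_qIdeles_pilotDataOfK D).choose_spec.2.2 pp x

/-- **THE K RECORD LINE: S_H (pinned reading) ⟺ the (xi-f) LICENCE** at abc-iut-c312-7's `settingPrVolSharp` over the `K`-level pilot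
datum `pilotDataOfK D K` with the K books' chosen realising q-ideles — ANY Θ-ideles `t ≠ 0`, ANY context/column binders, ANY `qK`, ANY
degree. So the antecedent `¬ S_H` of the (U)-K Szpiro-bad / content binders (`abc_of_SH_orNum_K_szpiroBad`, p460539's `hNumOffC`, …) is
LITERALLY the failure of the (xi-f) licence of the v5-L line (`abc_of_licence_v5K`). [cite: Mochizuki2012, IUTchIII Cor. 3.12 Step (xi-f)
p. 184] [cite: DupuyHilado2025, §3.9] [claim: Mochizuki2012, status: disputed] -/
theorem pilotKummerCompatHull_iff_licence_settingPrVolSharp_pilotDataOfK (ht0 : ∀ pp i x, t pp i x ≠ 0) :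
    Cor312Vol.PilotKummerCompatHull
        (LatticeSituation.ofShells (logShellsDH (pilotDataOfK D K) logv) M archPk archSub
          (summandPiecesPr (pilotDataOfK D K) hlog).Adm (summandPiecesPr (pilotDataOfK D K) hlog).logvol Ψ act Mmod region
          frobAdm frobLogvol frobΨ frobMmod unitImage ballImage thetaDiv)
        (settingPrVolSharp (pilotDataOfK D K) hlog M archPk archSub Ψ act Mmod region n lat sig split qData
          (exists_realising_qIdeles_pilotDataOfK D).choose t
          (exists_realising_qIdeles_pilotDataOfK D).choose_spec.1 (exists_realising_qIdeles_pilotDataOfK D).choose_spec.2.1)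
        (fun _ => (settingPrVolSharp (pilotDataOfK D K) hlog M archPk archSub Ψ act Mmod region n lat sig split qData
          (exists_realising_qIdeles_pilotDataOfK D).choose t
          (exists_realising_qIdeles_pilotDataOfK D).choose_spec.1 (exists_realising_qIdeles_pilotDataOfK D).choose_spec.2.1).qRegion)
        qK ↔
      Thm311ToCor312.Licence
        (settingPrVolSharp (pilotDataOfK D K) hlog M archPk archSub Ψ act Mmod region n lat sig split qData
          (exists_realising_qIdeles_pilotDataOfK D).choose t
          (exists_realising_qIdeles_pilotDataOfK D).choose_spec.1 (exists_realising_qIdeles_pilotDataOfK D).choose_spec.2.1) :=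
  pilotKummerCompatHull_settingPrVolSharp_iff_licence (pilotDataOfK D K) hlog M archPk archSub Ψ act Mmod region n lat sig split
    qData (exists_realising_qIdeles_pilotDataOfK D).choose t (exists_realising_qIdeles_pilotDataOfK D).choose_spec.1
    (exists_realising_qIdeles_pilotDataOfK D).choose_spec.2.1 frobAdm frobLogvol frobΨ frobMmod unitImage ballImage thetaDiv qK ht0
    (norm_choose_realising_qIdeles_pilotDataOfK_le_one D)

end Cor312Prov

end Summit.ABC.IUTFork

end
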